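import Summits.CriticalPhenomena.CardyFormulaZ2.Theses.CardyQContinuation
import Literature.Probability.Percolation.QuadCrossingSquareModel
import Literature.Probability.RandomPlanarGeometry.QuadPresentations
import Summits.CriticalPhenomena.CardyFormulaZ2.Theorems.CardyBoundaryCoulombGasRectilinearSufficesSquareModel

/-!
# An oriented square model of a conformal rectangle
(route CardyQContinuation, serves stmt-CriticalPhenomena-5560, registered stub
`stub_design_squareModel` of the n = 0 bridge of the crux `IsingJetsConformal`)

The n = 0 bridge of the crux sandwiches the FK-Ising crossing probability of a discretised quad
between Chelkak–Smirnov discrete quadrilaterals built on designed rectilinear polygons; the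
Chelkak–Smirnov boundary cycle runs counterclockwise, whereas a `ConformalRectangle` carries no
orientation. The design therefore starts from an **oriented square model** of the quad `R`:
a plane homeomorphism `Ψ` mapping the model square `(-1, 1)²` onto `R.carrier`, its bottom and
top sides onto `R.arc 0` and `R.arc 2` and the two other sides onto `R.arc 1 ∪ R.arc 3`, such that

* (orientation, with stability) every conformal rectangle whose boundary loop is uniformly close
  to the transported square loop `(unitSquareQuad.map Ψ).boundary = Ψ ∘ ∂(square)` has index `1`
  on its carrier;
* (Radó + relabelling) along every sequence of conformal rectangles with the quarter marks whose
  boundary loops converge uniformly to the transported square loop, the Cardy cross-ratios of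
  arbitrary uniformizing data converge to the modulus of `R`.

Construction. Let `Φ` be the square model of `R` respecting the corners
(`exists_isSquareModel_pt`). If `R.index = 1` on `R`, take `Ψ := Φ`: the quad
`unitSquareQuad.map Φ` has the carrier and the marked points of `R`, hence its index
(`ConformalRectangle.index_eq_index_of_pt_eq`). If `R.index = -1`
(`JordanDomain.index_eq_one_or_eq_neg_one`), take `Ψ := Φ ∘ N` with `N z = -z̄` the reflection
in the imaginary axis, which preserves the square, its bottom and top sides, swaps its right and
left sides and relabels its corners by `(0 1)(2 3)`; then `unitSquareQuad.map Ψ` has index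
`-R.index = 1` (`ConformalRectangle.index_eq_neg_index_of_pt_swap`). Stability of the index is
`JordanDomain.exists_forall_index_eq_one`, and the convergence of moduli is
`ConformalRectangle.tendsto_crossRatio_of_carrier_eq` (Radó, `CrossRatioContinuity.lean`, plus
the invariance of the cross-ratio under the Klein relabelling). [folklore]

References: Ch. Pommerenke, *Boundary Behaviour of Conformal Maps* (1992), §2.3 (Radó),
Cor. 2.9 (Schoenflies); D. Chelkak, S. Smirnov, Invent. Math. 189 (2012), §6.
-/

noncomputable section

namespace Summit.CriticalPhenomena.CardyFormulaZ2.Theorems.CardyQContinuation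

open Set Filter Metric Topology Complex
open scoped ComplexConjugate
open Literature.Probability.RandomPlanarGeometry Literature.Probability.Percolation

namespace DesignSquareModel

/-! ### The reflection `z ↦ -z̄` and the model square -/

/-- The reflection in the imaginary axis, as the plane homeomorphism
`conjLIE.toHomeomorph.trans (Homeomorph.neg ℂ) : z ↦ -z̄`. [folklore] -/
theorem negConj_apply (z : ℂ) :
    (Complex.conjLIE.toHomeomorph.trans (Homeomorph.neg ℂ)) z = -conj z := rfl

/-- The reflection `z ↦ -z̄` is an involution. [folklore] -/
theorem negConj_negConj (z : ℂ) :
    (Complex.conjLIE.toHomeomorph.trans (Homeomorph.neg ℂ))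
      ((Complex.conjLIE.toHomeomorph.trans (Homeomorph.neg ℂ)) z) = z := by
  simp

/-- Images under the reflection `z ↦ -z̄` are preimages. [folklore] -/
theorem image_negConj (s : Set ℂ) :
    (Complex.conjLIE.toHomeomorph.trans (Homeomorph.neg ℂ)) '' s =
      (Complex.conjLIE.toHomeomorph.trans (Homeomorph.neg ℂ)) ⁻¹' s :=
  congrFun (image_eq_preimage_of_inverse negConj_negConj negConj_negConj) s

/-- The reflection `z ↦ -z̄` maps the model square `(-1, 1)²` onto itself. [folklore] -/
theorem image_negConj_carrier :
    (Complex.conjLIE.toHomeomorph.trans (Homeomorph.neg ℂ)) '' unitSquareQuad.carrier =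
      unitSquareQuad.carrier := by
  rw [image_negConj]
  ext z
  simp only [mem_preimage, unitSquareQuad_carrier, Complex.mem_reProdIm, negConj_apply, neg_re,
    conj_re, neg_im, conj_im, neg_neg, mem_Ioo]
  constructor <;> rintro ⟨⟨h1, h2⟩, h3⟩ <;> exact ⟨⟨by linarith, by linarith⟩, h3⟩

/-- The reflection `z ↦ -z̄` maps the bottom side of the model square onto itself. [folklore] -/
theorem image_negConj_arc_zero :
    (Complex.conjLIE.toHomeomorph.trans (Homeomorph.neg ℂ)) '' unitSquareQuad.arc 0 =
      unitSquareQuad.arc 0 := by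
  rw [image_negConj]
  ext z
  simp only [mem_preimage, SquareModel.mem_arc_zero, negConj_apply, neg_re, conj_re, neg_im,
    conj_im, neg_neg, mem_Icc]
  constructor <;> rintro ⟨h1, h2, h3⟩ <;> exact ⟨h1, by linarith, by linarith⟩

/-- The reflection `z ↦ -z̄` maps the top side of the model square onto itself. [folklore] -/
theorem image_negConj_arc_two :
    (Complex.conjLIE.toHomeomorph.trans (Homeomorph.neg ℂ)) '' unitSquareQuad.arc 2 =
      unitSquareQuad.arc 2 := by
  rw [image_negConj]
  ext z
  simp only [mem_preimage, SquareModel.mem_arc_two, negConj_apply, neg_re, conj_re, neg_im,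
    conj_im, neg_neg, mem_Icc]
  constructor <;> rintro ⟨h1, h2, h3⟩ <;> exact ⟨h1, by linarith, by linarith⟩

/-- The reflection `z ↦ -z̄` maps the right side of the model square onto the left side.
[folklore] -/
theorem image_negConj_arc_one :
    (Complex.conjLIE.toHomeomorph.trans (Homeomorph.neg ℂ)) '' unitSquareQuad.arc 1 =
      unitSquareQuad.arc 3 := by
  rw [image_negConj]
  ext z
  simp only [mem_preimage, SquareModel.mem_arc_one, SquareModel.mem_arc_three, negConj_apply,
    neg_re, conj_re, neg_im, conj_im, neg_neg, mem_Icc]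
  constructor <;> rintro ⟨h1, h2, h3⟩ <;> exact ⟨by linarith, h2, h3⟩

/-- The reflection `z ↦ -z̄` maps the left side of the model square onto the right side.
[folklore] -/
theorem image_negConj_arc_three :
    (Complex.conjLIE.toHomeomorph.trans (Homeomorph.neg ℂ)) '' unitSquareQuad.arc 3 =
      unitSquareQuad.arc 1 := by
  rw [image_negConj]
  ext z
  simp only [mem_preimage, SquareModel.mem_arc_one, SquareModel.mem_arc_three, negConj_apply,
    neg_re, conj_re, neg_im, conj_im, neg_neg, mem_Icc]
  constructor <;> rintro ⟨h1, h2, h3⟩ <;> exact ⟨by linarith, h2, h3⟩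

/-- The reflection `z ↦ -z̄` relabels the corners of the model square by `(0 1)(2 3)`.
[folklore] -/
theorem negConj_pt :
    (Complex.conjLIE.toHomeomorph.trans (Homeomorph.neg ℂ)) (unitSquareQuad.pt 0) =
        unitSquareQuad.pt 1 ∧
      (Complex.conjLIE.toHomeomorph.trans (Homeomorph.neg ℂ)) (unitSquareQuad.pt 1) =
        unitSquareQuad.pt 0 ∧
      (Complex.conjLIE.toHomeomorph.trans (Homeomorph.neg ℂ)) (unitSquareQuad.pt 2) =
        unitSquareQuad.pt 3 ∧
      (Complex.conjLIE.toHomeomorph.trans (Homeomorph.neg ℂ)) (unitSquareQuad.pt 3) =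
        unitSquareQuad.pt 2 := by
  obtain ⟨e0, e1, e2, e3⟩ := RectilinearCardy.Negative.rectQuad_pt (x₀ := -1) (x₁ := 1)
    (y₀ := -1) (y₁ := 1) (by norm_num) (by norm_num)
  rw [show unitSquareQuad.pt 0 = ⟨-1, -1⟩ from e0, show unitSquareQuad.pt 1 = ⟨1, -1⟩ from e1,
    show unitSquareQuad.pt 2 = ⟨1, 1⟩ from e2, show unitSquareQuad.pt 3 = ⟨-1, 1⟩ from e3]
  simp only [negConj_apply]
  refine ⟨?_, ?_, ?_, ?_⟩ <;> apply Complex.ext <;> simp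

/-! ### The oriented square model -/

/-- **Oriented square model.** Every conformal rectangle `R` admits a plane homeomorphism `Ψ`
mapping the model square onto `R.carrier`, its bottom/top sides onto `R.arc 0`/`R.arc 2` and
its two other sides onto `R.arc 1 ∪ R.arc 3`, such that the transported quad
`unitSquareQuad.map Ψ` has the marked points of `R` (in the same order, or relabelled by
`(0 1)(2 3)`) and index `1` on the carrier. (`Ψ` is the square model `Φ` of
`exists_isSquareModel_pt` if `R.index = 1`, and `Φ ∘ (z ↦ -z̄)` if `R.index = -1`.)
[folklore] -/
theorem exists_oriented (R : ConformalRectangle) :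
    ∃ Ψ : ℂ ≃ₜ ℂ, Ψ '' unitSquareQuad.carrier = R.carrier ∧
      Ψ '' unitSquareQuad.arc 0 = R.arc 0 ∧ Ψ '' unitSquareQuad.arc 2 = R.arc 2 ∧
      Ψ '' (unitSquareQuad.arc 1 ∪ unitSquareQuad.arc 3) = R.arc 1 ∪ R.arc 3 ∧
      ((∀ k, (unitSquareQuad.map Ψ).pt k = R.pt k) ∨
        ((unitSquareQuad.map Ψ).pt 0 = R.pt 1 ∧ (unitSquareQuad.map Ψ).pt 1 = R.pt 0 ∧
          (unitSquareQuad.map Ψ).pt 2 = R.pt 3 ∧ (unitSquareQuad.map Ψ).pt 3 = R.pt 2)) ∧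
      ∀ z ∈ R.carrier, (unitSquareQuad.map Ψ).index z = 1 := by
  obtain ⟨Φ, hΦ, hpt⟩ := exists_isSquareModel_pt R
  obtain ⟨z₀, hz₀⟩ := R.nonempty
  have hzf : ∀ z ∈ R.carrier, z ∉ frontier R.carrier := fun z hz h =>
    Set.disjoint_left.1 R.disjoint_carrier_frontier hz h
  rcases R.index_eq_one_or_eq_neg_one hz₀ with h1 | h1
  · have hpt' : ∀ k, (unitSquareQuad.map Φ).pt k = R.pt k := fun k => by
      rw [MarkedDomain.pt_map, hpt]
    refine ⟨Φ, hΦ.image_carrier, hΦ.image_arc 0, hΦ.image_arc 2,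
      by rw [image_union, hΦ.image_arc, hΦ.image_arc], Or.inl hpt', fun z hz => ?_⟩
    rw [ConformalRectangle.index_eq_index_of_pt_eq R (unitSquareQuad.map Φ) hΦ.image_carrier
      hpt' (hzf z hz), R.index_eq_of_mem_carrier hz hz₀, h1]
  · set N : ℂ ≃ₜ ℂ := Complex.conjLIE.toHomeomorph.trans (Homeomorph.neg ℂ)
    obtain ⟨n0, n1, n2, n3⟩ := negConj_pt
    have himg : ∀ s : Set ℂ, (N.trans Φ) '' s = Φ '' (N '' s) := fun s => by
      rw [image_image]; rfl
    have hc : (N.trans Φ) '' unitSquareQuad.carrier = R.carrier := by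
      rw [himg, image_negConj_carrier, hΦ.image_carrier]
    have q0 : (unitSquareQuad.map (N.trans Φ)).pt 0 = R.pt 1 := by
      rw [MarkedDomain.pt_map, Homeomorph.trans_apply, n0, hpt]
    have q1 : (unitSquareQuad.map (N.trans Φ)).pt 1 = R.pt 0 := by
      rw [MarkedDomain.pt_map, Homeomorph.trans_apply, n1, hpt]
    have q2 : (unitSquareQuad.map (N.trans Φ)).pt 2 = R.pt 3 := by
      rw [MarkedDomain.pt_map, Homeomorph.trans_apply, n2, hpt]
    have q3 : (unitSquareQuad.map (N.trans Φ)).pt 3 = R.pt 2 := by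
      rw [MarkedDomain.pt_map, Homeomorph.trans_apply, n3, hpt]
    refine ⟨N.trans Φ, hc, ?_, ?_, ?_, Or.inr ⟨q0, q1, q2, q3⟩, fun z hz => ?_⟩
    · rw [himg, image_negConj_arc_zero, hΦ.image_arc]
    · rw [himg, image_negConj_arc_two, hΦ.image_arc]
    · rw [himg, image_union, image_negConj_arc_one, image_negConj_arc_three, image_union,
        hΦ.image_arc, hΦ.image_arc, union_comm]
    · rw [ConformalRectangle.index_eq_neg_index_of_pt_swap R (unitSquareQuad.map (N.trans Φ)) hc
        q0 q1 q2 q3 (hzf z hz), R.index_eq_of_mem_carrier hz hz₀, h1]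
      norm_num

end DesignSquareModel

open DesignSquareModel in
/-- **Registered stub `stub_design_squareModel`** of the n = 0 bridge of the crux
`IsingJetsConformal` (stmt-CriticalPhenomena-5560): every conformal rectangle `R` has an
oriented square model `Ψ : ℂ ≃ₜ ℂ` — (a) `Ψ` maps the model square onto `R.carrier`, its
bottom/top sides onto `R.arc 0`/`R.arc 2` and the two other sides onto `R.arc 1 ∪ R.arc 3`;
(b) every conformal rectangle whose boundary loop is uniformly `ε`-close to the transported
square loop has index `1` on its carrier; (c) along every sequence of conformal rectangles with
the quarter marks whose boundary loops converge uniformly to the transported square loop, the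
cross-ratios of arbitrary uniformizing data converge to the modulus of `R` (Radó). [folklore] -/
theorem stub_design_squareModel :
    (∀ R : Literature.Probability.RandomPlanarGeometry.ConformalRectangle, ∃ Ψ : ℂ ≃ₜ ℂ, Ψ '' Literature.Probability.Percolation.unitSquareQuad.carrier = R.carrier ∧ Ψ '' Literature.Probability.Percolation.unitSquareQuad.arc 0 = R.arc 0 ∧ Ψ '' Literature.Probability.Percolation.unitSquareQuad.arc 2 = R.arc 2 ∧ Ψ '' (Literature.Probability.Percolation.unitSquareQuad.arc 1 ∪ Literature.Probability.Percolation.unitSquareQuad.arc 3) = R.arc 1 ∪ R.arc 3 ∧ (∃ ε : ℝ, 0 < ε ∧ ∀ P : Literature.Probability.RandomPlanarGeometry.ConformalRectangle, (∀ s : ℝ, dist (P.boundary s) ((Literature.Probability.Percolation.unitSquareQuad.map Ψ).boundary s) ≤ ε) → ∀ z ∈ P.carrier, P.toJordanDomain.index z = 1) ∧ (∀ Q : ℕ → Literature.Probability.RandomPlanarGeometry.ConformalRectangle, TendstoUniformly (fun m ↦ (Q m).boundary) (Literature.Probability.Percolation.unitSquareQuad.map Ψ).boundary Filter.atTop → (∀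 m i, (Q m).mark i = Literature.Probability.Percolation.quarterMarks i) → ∀ (ψ : ∀ m, Literature.Probability.RandomPlanarGeometry.ConformalEquiv UpperHalfPlane.upperHalfPlaneSet (Q m).carrier) (y : ℕ → Fin 4 → ℝ), (∀ m, (Q m).IsUniformizing (ψ m) (y m)) → ∀ (φ : Literature.Probability.RandomPlanarGeometry.ConformalEquiv UpperHalfPlane.upperHalfPlaneSet R.carrier) (x : Fin 4 → ℝ), R.IsUniformizing φ x → Filter.Tendsto (fun m ↦ Literature.Probability.RandomPlanarGeometry.crossRatio (y m)) Filter.atTop (nhds (Literature.Probability.RandomPlanarGeometry.crossRatio x)))) := by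
  intro R
  obtain ⟨Ψ, hc, h0, h2, h13, hpt, hidx⟩ := exists_oriented R
  obtain ⟨z₀, hz₀⟩ := R.nonempty
  have hz₀' : z₀ ∈ (unitSquareQuad.map Ψ).carrier := by rw [MarkedDomain.carrier_map, hc]; exact hz₀
  obtain ⟨ε, hε, hstab⟩ :=
    (unitSquareQuad.map Ψ).exists_forall_index_eq_one hz₀' (hidx z₀ hz₀)
  exact ⟨Ψ, hc, h0, h2, h13, ⟨ε, hε, fun P hP => hstab P.toJordanDomain hP⟩,
    fun Q hJ hm ψ y hψ φ x hφ =>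
      ConformalRectangle.tendsto_crossRatio_of_carrier_eq R (unitSquareQuad.map Ψ) hc hpt hJ hm
        ψ y hψ φ x hφ⟩

end Summit.CriticalPhenomena.CardyFormulaZ2.Theorems.CardyQContinuation

end
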